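import Mathlib
import Summits.ValiantsHypothesis.ValiantsHypothesis.Theses.LiouvilleSarnak
import Summits.ValiantsHypothesis.ValiantsHypothesis.Theorems.LiouvilleSarnakLiouvilleCutRankBlockEntropy

/-!
# Route LiouvilleSarnak — crux `LiouvilleCutRank` (stmt-ValiantsHypothesis-14775):
# positive UPPER sign-pattern entropy already suffices

`Theorems/LiouvilleSarnakLiouvilleCutRankBlockEntropy.lean` proved the entropy criterion
`liouvilleCutRank_of_patternEntropy` with the hypothesis "`≥ 2^{η L}` sign patterns of length `L` for ALL
large `L`".  Here the hypothesis is weakened to "for ARBITRARILY LARGE `L`" (positive upper growth rate,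
any sparse sequence of good lengths, windows at arbitrary positions):

* `card_windows_mono` — the number of distinct windows `(λ(m+1), …, λ(m+L))`, `m < M`, is monotone in `L`.
* ★ `liouvilleCutRank_of_upperPatternEntropy` :
  `(∃ η > 0, ∀ L₀, ∃ L ≥ L₀, ∃ M, 2^{η L} ≤ #{(λ(m+1), …, λ(m+L)) : m < M}) → LiouvilleCutRank`.
  (Round a good length `L` up to the next `B = 4^{t+1} ≤ 4L`; then `2^{(η/4) B} ≤ p(B) ≤ B · a(B)²` with
  `a(B)` the number of aligned `B`-block patterns, and `BlockEntropy.liouvilleCutRank_of_blockComplexity`.)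

For the subword complexity the growth rate `lim (log p(L))/L` exists (Fekete), so upper and lower
positive entropy coincide; this file simply spares users that detour.  Honest framing: a conditional
criterion; `LiouvilleCutRank`, `DigitalBilinearLiouville`, `AlgebraicSarnak` stay OPEN; nothing here bears
on VP versus VNP.  No definitions.
-/

-- the directory `ValiantsHypothesis/ValiantsHypothesis` repeats the summit name (tree layout)
set_option linter.dupNamespace false

namespace Summit.ValiantsHypothesis.ValiantsHypothesis.Theorems.LiouvilleSarnakLiouvilleCutRank.BlockEntropy

open Finset ArithmeticFunction

open Summit.ValiantsHypothesis.ValiantsHypothesis.Theses.LiouvilleSarnak (LiouvilleCutRank)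

/-- The number of distinct sign windows of `λ` of length `L` at positions `m < M` is monotone in `L`
(restrict a longer window to its prefix). [folklore] -/
theorem card_windows_mono {L B : ℕ} (hLB : L ≤ B) (M : ℕ) :
    ((range M).image fun m : ℕ => fun j : Fin L => (liouville (m + j + 1) : ℤ)).card ≤
      ((range M).image fun m : ℕ => fun j : Fin B => (liouville (m + j + 1) : ℤ)).card := by
  classical
  have heq : ((range M).image fun m : ℕ => fun j : Fin L => (liouville (m + j + 1) : ℤ)) =
      (((range M).image fun m : ℕ => fun j : Fin B => (liouville (m + j + 1) : ℤ)).image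
        fun w : Fin B → ℤ => fun j : Fin L => w (Fin.castLE hLB j)) := by
    rw [image_image]
    rfl
  rw [heq]
  exact card_image_le

/-- ★ **Positive upper sign-pattern entropy of `λ` implies `LiouvilleCutRank`.**  If there is `η > 0`
such that for ARBITRARILY LARGE `L` the Liouville sequence shows at least `2^{η L}` distinct sign patterns
`(λ(m+1), …, λ(m+L))`, then for every `W` eventually every balanced digital cut matrix of `λ` has rank
`≥ W`.  (Round `L` up to `B = 4^{t+1} ≤ 4L`: `2^{(η/4) B} ≤ p(B) ≤ B · a(B)²` by `card_windows_mono`,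
`card_windows_le`; then `liouvilleCutRank_of_blockComplexity`.) [folklore] -/
theorem liouvilleCutRank_of_upperPatternEntropy
    (h : ∃ η : ℝ, 0 < η ∧ ∀ L₀ : ℕ, ∃ L : ℕ, L₀ ≤ L ∧ ∃ M : ℕ, (2 : ℝ) ^ (η * L) ≤
      ((range M).image fun m : ℕ => fun j : Fin L => (liouville (m + j + 1) : ℤ)).card) :
    LiouvilleCutRank := by
  classical
  obtain ⟨η, hη, hL⟩ := h
  apply liouvilleCutRank_of_blockComplexity
  intro C
  -- a threshold `t₁` with `(η/4) 2^{t₁} ≥ 2C + 2`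
  obtain ⟨t₁, ht₁⟩ := exists_nat_ge ((2 * C + 2) / (η / 4))
  have ht₁' : (2 * (C : ℝ) + 2) ≤ η / 4 * (2 : ℝ) ^ t₁ := by
    have h0 : (t₁ : ℝ) ≤ (2 : ℝ) ^ t₁ := by exact_mod_cast (Nat.lt_two_pow_self (n := t₁)).le
    have h1 : (2 * (C : ℝ) + 2) / (η / 4) ≤ (2 : ℝ) ^ t₁ := ht₁.trans h0
    rw [div_le_iff₀ (by positivity)] at h1
    linarith [h1]
  -- a good length `L ≥ 4^{t₁}` and its dyadic rounding `4^t ≤ L < 4^{t+1}`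
  obtain ⟨L, hL₀, M, hM⟩ := hL (2 ^ (2 * t₁))
  have hLpos : 0 < L := lt_of_lt_of_le (Nat.two_pow_pos _) hL₀
  set t : ℕ := Nat.log2 L / 2 with htdef
  have hlog := Nat.log2_self_le (Nat.ne_of_gt hLpos)   -- 2 ^ log2 L ≤ L
  have hlog' := Nat.lt_log2_self (n := L)               -- L < 2 ^ (log2 L + 1)
  have h4t : 2 ^ (2 * t) ≤ L := (Nat.pow_le_pow_right Nat.two_pos (by omega)).trans hlog
  have hL4 : L < 2 ^ (2 * (t + 1)) := hlog'.trans_le (Nat.pow_le_pow_right Nat.two_pos (by omega))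
  have ht₁t : t₁ ≤ t := by
    by_contra hlt
    push Not at hlt
    have : 2 ^ (2 * (t + 1)) ≤ 2 ^ (2 * t₁) := Nat.pow_le_pow_right Nat.two_pos (by omega)
    omega
  set s : ℕ := t + 1 with hsdef
  set B : ℕ := 2 ^ (2 * s) with hBdef
  have hBpos : 0 < B := Nat.two_pow_pos _
  have hLB : L ≤ B := hL4.le
  have hB4L : (B : ℝ) ≤ 4 * L := by
    have : B ≤ 4 * L := by
      have hB : B = 4 * 2 ^ (2 * t) := by rw [hBdef, hsdef]; ring_nf
      omega
    exact_mod_cast this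
  -- `(η/4)·2^s ≥ 2C + 2`
  have h2s : (2 * (C : ℝ) + 2) ≤ η / 4 * (2 : ℝ) ^ s := by
    have : (2 : ℝ) ^ t₁ ≤ (2 : ℝ) ^ s := pow_le_pow_right₀ one_le_two (by omega)
    nlinarith [ht₁', this, hη]
  refine ⟨s, M / B + 2, ?_⟩
  set a : ℕ := ((range (M / B + 2)).image fun H : ℕ => fun j : Fin (2 ^ (2 * s)) =>
      (liouville (2 ^ (2 * s) * H + j + 1) : ℤ)).card with ha
  by_contra hle
  push Not at hle
  -- `2^{η L} ≤ p_L(M) ≤ p_B(M) ≤ B a² ≤ 2^{2s + 2 C 2^s}`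
  have hwin := card_windows_le B M hBpos
  rw [hBdef] at hwin
  have hmono := card_windows_mono hLB M
  rw [hBdef] at hmono
  have hchain : ((range M).image fun m : ℕ => fun j : Fin L =>
      (liouville (m + j + 1) : ℤ)).card ≤ 2 ^ (2 * s + 2 * (C * 2 ^ s)) := by
    calc _ ≤ _ := hmono
      _ ≤ 2 ^ (2 * s) * (a * a) := hwin
      _ ≤ 2 ^ (2 * s) * (2 ^ (C * 2 ^ s) * 2 ^ (C * 2 ^ s)) :=
          Nat.mul_le_mul_left _ (Nat.mul_le_mul hle hle)
      _ = 2 ^ (2 * s + 2 * (C * 2 ^ s)) := by rw [← pow_add, ← pow_add]; ring_nf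
  have hreal : (2 : ℝ) ^ (η * (L : ℕ)) ≤ (2 : ℝ) ^ ((2 * s + 2 * (C * 2 ^ s) : ℕ) : ℝ) := by
    rw [Real.rpow_natCast]
    refine hM.trans ?_
    exact_mod_cast hchain
  have hexp : η * (L : ℕ) ≤ ((2 * s + 2 * (C * 2 ^ s) : ℕ) : ℝ) :=
    (Real.rpow_le_rpow_left_iff (by norm_num : (1 : ℝ) < 2)).mp hreal
  -- but `η L ≥ (η/4) B = (η/4) 2^s 2^s ≥ (2C+2) 2^s > 2C 2^s + 2s`
  have hB2 : ((B : ℕ) : ℝ) = (2 : ℝ) ^ s * (2 : ℝ) ^ s := by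
    rw [hBdef]; push_cast; rw [← pow_add]; ring_nf
  have hlow : (2 * (C : ℝ) + 2) * (2 : ℝ) ^ s ≤ η * (L : ℕ) := by
    have h1 : (2 * (C : ℝ) + 2) * (2 : ℝ) ^ s ≤ η / 4 * (2 : ℝ) ^ s * (2 : ℝ) ^ s :=
      mul_le_mul_of_nonneg_right h2s (by positivity)
    have h2 : η / 4 * (2 : ℝ) ^ s * (2 : ℝ) ^ s = η / 4 * (B : ℕ) := by rw [hB2]; ring
    rw [h2] at h1
    have h3 : η / 4 * ((B : ℕ) : ℝ) ≤ η * (L : ℕ) := by nlinarith [hB4L, hη]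
    exact h1.trans h3
  have hcast : ((2 * s + 2 * (C * 2 ^ s) : ℕ) : ℝ) = 2 * (s : ℝ) + 2 * (C : ℝ) * (2 : ℝ) ^ s := by
    push_cast; ring
  rw [hcast] at hexp
  have hfin : (2 * (C : ℝ) + 2) * (2 : ℝ) ^ s ≤ 2 * (s : ℝ) + 2 * (C : ℝ) * (2 : ℝ) ^ s :=
    hlow.trans hexp
  have hlt : (s : ℝ) < (2 : ℝ) ^ s := by exact_mod_cast Nat.lt_two_pow_self (n := s)
  have key : (2 : ℝ) ^ s ≤ s := by linarith [hfin]
  linarith [key, hlt]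

end Summit.ValiantsHypothesis.ValiantsHypothesis.Theorems.LiouvilleSarnakLiouvilleCutRank.BlockEntropy
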